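import Mathlib
import Summits.Ventures.PercRepro2.SwAllMarkStepThm
import Summits.Ventures.PercRepro2.SwOutNeverCoreGTyped
import Summits.Ventures.PercRepro2.SwOutJunctionGTyped

/-!
# THE GENERAL MARK STEP, III: the step on the lane's classes
(blind cell PercRepro2, night-4 g31, 2026-08-28; proofs/NIGHT4-G31.md)

The general mark step (`swAll_of_gTyped_patterns`) asks for the doubly typed row of the graph with
the edges at the mark `x` deleted, on every colour pattern of those edges.  Night-4 g30 has that
row on g10's class (`gTypedSwAll_of_outEdges`, used in `swAll_markStep_of_outEdges`), on g28's
never-core and bridge classes (`gTypedSwAll_of_neverCoreF`, `gTypedSwAll_of_bridges`) and on g11's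
one-junction class (`gTypedSwAll_of_junction`).  On every pattern the EXEMPT vertices are the mark
(`X = {x}`) and its red neighbours (forced out of `C_R(h)` by `𝓓″`); hence row 2′SW-ALL with the
mark at `x` holds on every graph whose vertices other than `l, h, x` are never a core in the
isolated graph (`swAll_markStep_of_neverCore`: joined to `l`, hanging on `x` only, separated from
`h` by one edge or by one never-core vertex of the graph with `l` and `x` removed —
`swAll_markStep_of_bridges` is the one-edge case), and on every graph with ONE junction `u` (a
vertex of any adjacency — to `x` included — whose neighbours other than `h` and `x` are joined
to `h`; on the patterns where `u` is a red neighbour of `x` it is exempt and g10's theorem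
applies, on the others the junction theorem with `𝓓″` blind to `u`): `swAll_markStep_of_junction`.
-/

namespace Summit.Ventures.PercRepro2

namespace LocRows

open Hull

variable {V : Type*} {E : Type*} [Fintype E] [DecidableEq E]

open scoped Classical

section Mono

variable {ends : E → Sym2 V} {U : Set V} {h : V}

omit [Fintype E] in
/-- `NeverCoreF` is monotone in the forced predicate. -/
theorem NeverCoreF.mono {F F' : V → Prop} (hFF : ∀ y, F y → F' y) {y : V}
    (hN : NeverCoreF ends U h F y) : NeverCoreF ends U h F' y := by
  induction hN with
  | out x e y hxy hy => exact NeverCoreF.out x e y hxy hy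
  | iso x hx => exact NeverCoreF.iso x hx
  | forced x hx => exact NeverCoreF.forced x (hFF x hx)
  | edge x e₀ hx => exact NeverCoreF.edge x e₀ hx
  | vertex x w _ hwx hwh hx ih => exact NeverCoreF.vertex x w ih hwx hwh hx

end Mono

section Classes

variable {ends : E → Sym2 V} {x l h : V}

omit [Fintype E] [DecidableEq E] in
/-- A vertex `y ≠ x` whose every edge goes to `x` is isolated in the isolated graph. -/
lemma isolate_iso {y : V} (hyx : y ≠ x) (hiso : ∀ e, y ∈ ends e → x ∈ ends e) :
    ∀ e, y ∉ isolate ends x e := by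
  intro e hye
  by_cases hxe : x ∈ ends e
  · rw [isolate_apply_of_mem hxe, Sym2.mem_iff] at hye
    rcases hye with h' | h' <;> exact hyx h'
  · rw [isolate_apply_of_notMem hxe] at hye
    exact hxe (hiso e hye)

omit [Fintype E] [DecidableEq E] in
/-- The mark and its red neighbours are exempt on every pattern. -/
lemma markF_exempt (d : Config E) : ∀ y, (y = x ∨ y ∈ openNbrs ends d x) →
    (∀ S ∈ markU ends d x, y ∈ S) ∨ (∀ S ∈ markD'' ends d x, y ∉ S) ∨ y ∈ ({x} : Set V) := by
  rintro y (rfl | hy)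
  · exact Or.inr (Or.inr (Set.mem_singleton _))
  · exact Or.inr (Or.inl fun S hS => hS y hy)

/-- **The general mark step on g28's never-core class of the isolated graph, pattern by
pattern**: every vertex other than `l, h` never a core in the isolated graph with the mark and the
red neighbours of the pattern forced. -/
theorem swAll_markStep_of_neverCoreF (hlh : l ≠ h) (hloop : ∀ e, ends e ≠ s(h, h)) (hxl : x ≠ l)
    (hxh : x ≠ h)
    (hN : ∀ d ∈ pats {e | x ∈ ends e}, ∀ y, y ≠ l → y ≠ h →
      NeverCoreF (isolate ends x) ({l}ᶜ) h (fun y => y = x ∨ y ∈ openNbrs ends d x) y) :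
    SwAll ends l h x := by
  refine swAll_of_gTyped_patterns hxl hxh fun d hd => ?_
  exact gTypedSwAll_of_neverCoreF hlh (isolate_hloop hxh hloop) (isUpperSet_markU d x)
    (isLowerSet_markD d x) (isLowerSet_markD'' d x) isUpperSet_univ (markF_exempt d) (hN d hd)

/-- **THE GENERAL MARK STEP ON g28's NEVER-CORE CLASS** (unconditional, pattern-free): row
2′SW-ALL with the mark at `x ∉ {l, h}` on every graph without loop at `h` in which every vertex
other than `l, h` is never a core in the isolated graph with the mark forced (joined to `l`,
isolated, or separated from `h` by one edge or one never-core vertex of the graph with `l` and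
`x` removed). -/
theorem swAll_markStep_of_neverCore (hlh : l ≠ h) (hloop : ∀ e, ends e ≠ s(h, h)) (hxl : x ≠ l)
    (hxh : x ≠ h)
    (hN : ∀ y, y ≠ l → y ≠ h → NeverCoreF (isolate ends x) ({l}ᶜ) h (· = x) y) :
    SwAll ends l h x :=
  swAll_markStep_of_neverCoreF hlh hloop hxl hxh fun _ _ y hyl hyh =>
    NeverCoreF.mono (fun _ hy => Or.inl hy) (hN y hyl hyh)

/-- **THE GENERAL MARK STEP ON g28's BRIDGE CLASS**: every vertex other than `l, h, x` joined to
`l`, hanging on `x` only, or separated from `h` by one edge of the graph with `l` and `x`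
removed. -/
theorem swAll_markStep_of_bridges (hlh : l ≠ h) (hloop : ∀ e, ends e ≠ s(h, h)) (hxl : x ≠ l)
    (hxh : x ≠ h)
    (hbr : ∀ y, y ≠ l → y ≠ h → y ≠ x →
      (∃ e, ends e = s(y, l)) ∨ (∀ e, y ∈ ends e → x ∈ ends e) ∨
      ∃ e₀, y ∉ cluster (isolate ends x) (cutConfig (isolate ends x) ({l}ᶜ) e₀) h) :
    SwAll ends l h x := by
  refine swAll_markStep_of_neverCore hlh hloop hxl hxh fun y hyl hyh => ?_
  by_cases hyx : y = x
  · exact NeverCoreF.forced y hyx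
  rcases hbr y hyl hyh hyx with ⟨e, he⟩ | hiso | ⟨e₀, hy⟩
  · exact NeverCoreF.out y e l (isolate_eq_of_ends_eq hyx hxl.symm he) (by simp)
  · exact NeverCoreF.iso y (isolate_iso hyx hiso)
  · exact NeverCoreF.edge y e₀ hy

/-- **THE GENERAL MARK STEP WITH ONE JUNCTION** (g11's class of the isolated graph): a vertex
`u ∉ {l, h, x}` without loop whose neighbours other than `h` and `x` are joined to `h`, every
other vertex joined to `l` or hanging on `x` only; `u` may be joined to `x` (on the patterns where
it is a red neighbour of `x` it is exempt, on the others the condition on `C_R(h)` is blind to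
it). -/
theorem swAll_markStep_of_junction (hlh : l ≠ h) (hloop : ∀ e, ends e ≠ s(h, h)) (hxl : x ≠ l)
    (hxh : x ≠ h) {u : V} (hul : u ≠ l) (huh : u ≠ h) (hux : u ≠ x)
    (hloop_u : ∀ e, ends e ≠ s(u, u))
    (hadj : ∀ e y, ends e = s(u, y) → y ≠ h → y ≠ x → ∃ e', ends e' = s(y, h))
    (hout : ∀ y, y ≠ l → y ≠ h → y ≠ u → y ≠ x →
      (∃ e, ends e = s(y, l)) ∨ (∀ e, y ∈ ends e → x ∈ ends e)) : SwAll ends l h x := by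
  refine swAll_of_gTyped_patterns hxl hxh fun d _ => ?_
  by_cases huR : u ∈ openNbrs ends d x
  · -- `u` is a red neighbour of the mark: exempt, g10's class
    refine gTypedSwAll_of_outEdges hlh (isolate_hloop hxh hloop) (isUpperSet_markU d x)
      (isLowerSet_markD d x) (isLowerSet_markD'' d x) isUpperSet_univ ?_
    intro y hyl hyh
    by_cases hyu : y = u
    · subst hyu
      exact Or.inr (Or.inl fun S hS => hS y huR)
    by_cases hyx : y = x
    · exact Or.inr (Or.inr (Or.inl (by simp [hyx])))
    rcases hout y hyl hyh hyu hyx with ⟨e, he⟩ | hiso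
    · exact Or.inr (Or.inr (Or.inr (Or.inl ⟨e, isolate_eq_of_ends_eq hyx hxl.symm he⟩)))
    · exact Or.inr (Or.inr (Or.inr (Or.inr (isolate_iso hyx hiso))))
  · -- the junction theorem, the condition on `C_R(h)` blind to `u`
    refine gTypedSwAll_of_junction (F := fun y => y = x) hlh hul.symm huh.symm
      (isolate_hloop hxh hloop) (isolate_hloop hux.symm hloop_u) (isUpperSet_markU d x)
      (isLowerSet_markD d x) (isLowerSet_markD'' d x) isUpperSet_univ ?_ ?_ ?_ ?_ ?_ ?_
    · intro S hS y hy hyS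
      rw [Set.mem_insert_iff] at hyS
      rcases hyS with rfl | hyS
      · exact huR hy
      · exact hS y hy hyS
    · intro S _
      exact Set.mem_univ _
    · simpa using hux
    · rintro y rfl
      exact Or.inr (Or.inr (Set.mem_singleton _))
    · intro e he hoh
      have hxe : x ∉ ends e := by
        intro hxe
        rw [isolate_apply_of_mem hxe, Sym2.mem_iff] at he
        rcases he with h' | h' <;> exact hux h'
      have hends : ends e = s(u, Sym2.Mem.other he) := by
        rw [← isolate_apply_of_notMem hxe]
        exact (Sym2.other_spec he).symm
      have hox : Sym2.Mem.other he ≠ x := by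
        intro h'
        apply hxe
        rw [hends, h']
        exact Sym2.mem_mk_right _ _
      obtain ⟨e', he'⟩ := hadj e _ hends hoh hox
      exact ⟨e', isolate_eq_of_ends_eq hox hxh.symm he'⟩
    · intro y hyl hyh hyu
      by_cases hyx : y = x
      · exact Or.inl hyx
      rcases hout y hyl hyh hyu hyx with ⟨e, he⟩ | hiso
      · exact Or.inr (Or.inl ⟨e, isolate_eq_of_ends_eq hyx hxl.symm he⟩)
      · exact Or.inr (Or.inr (isolate_iso hyx hiso))

end Classes

end LocRows

end Summit.Ventures.PercRepro2
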